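import Literature.NumberTheory.LFunctions.Zhang2022.DetectorDictShiftC0Zero
import Literature.NumberTheory.LFunctions.Zhang2022.DetectorShiftPSDSharpTwist

/-!
# Zhang (2022), programme F-S3 (cell landau-siegel §E, seat ls-barrier-p6; KNIFE-EDGES §4 K8 / ESTAR §2 E*-S(i),
# BARRIER-STATE §2′ N6 (i)): ON THE HYPERSURFACE `c₀(b) = Re A₀(b) = 0` the two-sided shift form is a RANK-ONE jet
# form — the COMPLETE sharpness equivalence for `Det.DictShiftPSD`

Y. Zhang, *Discrete mean estimates and the Landau–Siegel zero*, arXiv:2211.02515v1 [Zhang2022LandauSiegel] —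
an unrefereed manuscript under adjudication. **WHAT THIS IS NOT: not a claim about Theorems 1–2 of
arXiv:2211.02515, about Landau–Siegel zeros, about a repaired `Margin232`, or about Parity. The programme SEARCHES
and TYPES; no claim about Landau–Siegel zeros, Theorems 1–2 of arXiv:2211.02515 or a repaired Margin232 until a
kernel theorem says so.** A SUPPORT leaf (row word ls-barrier-plan g2 2026-08-27T05:22:07Z; statement guard
ls-theory g3 05:27:54Z (G1)–(G4)); it moves no §E verdict word.

CONTEXT. The sharpness theorem of the cell's two-sided («windowed, glued») shift form
`Det.dictShiftPSD_iff_signAdmissible_of_ne` (`DetectorShiftPSDSharpTwist`, ls-barrier-num):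
`Det.DictShiftPSD b ↔ Det.SignAdmissible b` for sorted positive triples OFF the hypersurface `c₀(b) = 0`,
`c₀(b) = Re A₀(b) = Re Σ_j W_j(b)`; and `DetectorDictShiftC0Zero` (ls-num-2): the proviso is needed
(`b = (1,3,7)`: PSD, not sign-admissible, `c₀ = 0`). By [K1‴] (`Det.dictShift_eq_bulk_add_jets`) the form is
`(π/2)·DictShift_b(G) = c₀(b)·T_b^{[0,1]}(S_G) + J_b(G(0), G(1), ∫₀¹G)` with the JET FORM
`J_b(a₀,a₁,I) = freeEndForm b I (−a₀) + freeEndForm b 0 (−conj a₁) + π·Re crossJet b a₀ a₁ I`, a Hermitian form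
`v* M_b v` on `ℂ³` (`Det.jetMat`, Part 0–1). This file proves:

* Part 2 **[the nine minors]**: every `2 × 2` minor of `M_b` is `c₀(b)` times an EXPLICIT trigonometric polynomial
  (pairwise distinct `b`, `b_j ≠ 0`) — six identities (the other three are their conjugates), e.g.
  `m₀₀m₁₁ − |m₀₁|² = c₀·π²((e₂ − e₁²/4)c₀ − Re A_N)` (⟺ `|Σ_jW′_j + c_g|² = 4κ² + 4c₀(Re A_N − (e₂ − e₁²/4)c₀)`),
  `m₀₀m₂₂ − |m₀₂|² = c₀·(π⁴e₃/4)(2Re A_b − e₁c₀)`, `m₀₀m₁₂ − m₀₂m₁₀ = c₀·(iπ³/2)(e₃A₀ − (e₁/2)A_N)`,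
  `m₀₁m₂₂ − m₀₂m₂₁ = −c₀·(π⁴e₃/4)·conj(A_{N/b} + u₀u₁u₂)`. MECHANISM: the jets of the unit bridge solve a `4 × 4`
  interpolation system of determinant `π²·D(b) ∝ c₀(b)` (`Det.doublingDet_eq_re_sum_shiftW`), so `M_b` is a Jacobi
  (adjugate-type) matrix whose `2 × 2` minors carry the factor `det ∝ c₀`. The quotients were found by exact
  Laurent-polynomial division in `ℚ(i)[b,π][u^{±1}]` (this seat) and cross-checked two further ways (ls-num-2 g5:
  exact evaluation in `ℚ(ζ₁₆)[π]` at 157 algebraic triples; full symbolic expansion, kit j269742); here each is ONE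
  `field_simp`/`ring_nf` identity over the half-angle units `u_j = e^{iπb_j/2}` (`DetectorDoublingAtoms`).
* Part 3 **[rank one]**: on `{c₀ = 0}` all nine minors of `M_b` vanish (`jetMat_minors_eq_zero`), hence
  (Cayley–Hamilton, `tr M·M − M² = e₂(M)·1 − adj M`) `λ_b·J_b(v) = ‖M_b v‖²` and `πκ_b·J_b(v) = |(M_b v)₀|²`, with the
  EXPLICIT trace `λ_b = Det.jetTrace b = 2πκ_b − (π³/2)e₃·Im A₀`, `κ_b = Det.jetKappa b = Im A_b − e₁·Im A₀/2`.
* Part 4 **[the form on the locus]**: for every kinked profile `G`, `λ_b·(π/2)·DictShift_b(G) = ‖M_b(G(0),G(1),∫G)‖²`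
  and (ls-num-2's explicit rank-one form) `κ_b·DictShift_b(G) = 2·‖κ_b·G(0) + (i/2)·conj Y_b·G(1) − (π/2)·conj A_N·∫G‖²`;
  on the sub-locus `κ_b = 0`: `DictShift_b(G) = −π²e₃·Im A₀·‖∫G‖²`.
* Part 5 **[the complete equivalence]**: on the locus `DictShiftPSD b ↔ 0 ≤ λ_b` (and `↔ 0 < κ_b` when `κ_b ≠ 0`);
  for every sorted positive triple (the hypotheses of the tree's iff, no proviso):
  **`Det.dictShiftPSD_iff_complete : DictShiftPSD b ↔ SignAdmissible b ∨ (Re A₀(b) = 0 ∧ 0 ≤ λ_b)`**;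
  unit tests: the five kernel instances of `DetectorDictShiftC0Zero` ((2,3,4), (1,2,4), (1,3,5): `λ_b < 0`, not PSD;
  (1,3,7): `λ_b = 2π > 0`, PSD; (2,4,6): `λ_b = 0`, PSD) recovered from the general theorem.

0 named facts; 0 sorries; standard axioms; no kit core-hours. References: arXiv:2211.02515v1 §2 Lemma 2.3 (2.13);
§4 (4.1); Prop. 7.1 p.44 with (7.19)–(7.21), (8.11)–(8.23); Prop 14.1; Lemma 15.1; §18 (18.1).
[cite: Zhang2022LandauSiegel, §§2, 4, 7–8, 14–15, 18]
-/

noncomputable section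

open Complex Real ComplexConjugate Set MeasureTheory intervalIntegral

namespace Literature.NumberTheory.LFunctions.Zhang2022

namespace Det

open Repair

variable {b : Fin 3 → ℝ} {G G' : ℝ → ℂ}

/-! ### Part 0 — the jet matrix of K1‴ and its trace -/

/-- `κ_b := Im A_b(b) − e₁(b)·Im A₀(b)/2` — the common diagonal coefficient of the two free-end forms of K1‴ in the
value jets `a₀ = G(0)`, `a₁ = G(1)` (the cell's `κ₁₁/4`). [cite: Zhang2022LandauSiegel, Prop 7.1 p.44 with (8.11)–(8.23)] -/
def jetKappa (b : Fin 3 → ℝ) : ℝ := (atomAb b).im - symE1 b * (atomA0 b).im / 2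

/-- `Y_b := Σ_j W′_j(b) + c_g(b)` — the coefficient of `−i·a₀·conj a₁` in K1‴'s cross jet form `Det.crossJet`
(`Det.shiftGlueW`, `Det.shiftGlue0`; `= A_b − e₁A₀ + (e₂/e₃)A_N + c_g` by `Det.sum_shiftGlueW_eq_atoms`).
[cite: Zhang2022LandauSiegel, Prop 14.1; Lemma 15.1; §18 (18.1)] -/
def jetY (b : Fin 3 → ℝ) : ℂ := (∑ j : Fin 3, shiftGlueW b j) + shiftGlue0 b

/-- `λ_b := 2πκ_b − (π³/2)·e₃(b)·Im A₀(b)` — the TRACE of the jet matrix `Det.jetMat b` (`jetMat_trace`); the one real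
number whose sign decides `Det.DictShiftPSD b` on the hypersurface `c₀(b) = 0` (`dictShiftPSD_iff_jetTrace_nonneg`).
[cite: Zhang2022LandauSiegel, Prop 7.1 p.44 with (8.11)–(8.23); §18 (18.1)] -/
def jetTrace (b : Fin 3 → ℝ) : ℝ := 2 * π * jetKappa b - π ^ 3 / 2 * symE3 b * (atomA0 b).im

/-- **The jet matrix** `M_b` — the `3 × 3` Hermitian matrix of K1‴'s apex block
`J_b(a₀,a₁,I) = freeEndForm b I (−a₀) + freeEndForm b 0 (−conj a₁) + π·Re crossJet b a₀ a₁ I` in the jet vector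
`v = (a₀, a₁, I) = (G(0), G(1), ∫₀¹G)` (`jetForm_eq_jetMat`: `J_b(v) = v* M_b v`); rows/columns `(a₀, a₁, I)`:
`m₀₀ = m₁₁ = πκ_b`, `m₂₂ = −(π³/2)e₃·Im A₀`, `m₀₁ = iπ·conj Y_b/2`, `m₀₂ = −π²·conj A_N/2`, `m₁₂ = −π²·A_N/2`.
[cite: Zhang2022LandauSiegel, Prop 7.1 p.44 with (8.11)–(8.23); Prop 14.1; Lemma 15.1; §18 (18.1)] -/
def jetMat (b : Fin 3 → ℝ) : Matrix (Fin 3) (Fin 3) ℂ :=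
  !![((π * jetKappa b : ℝ) : ℂ), I * π * conj (jetY b) / 2, -(π : ℂ) ^ 2 * conj (atomAN b) / 2;
     -(I * π * jetY b) / 2, ((π * jetKappa b : ℝ) : ℂ), -(π : ℂ) ^ 2 * atomAN b / 2;
     -(π : ℂ) ^ 2 * atomAN b / 2, -(π : ℂ) ^ 2 * conj (atomAN b) / 2, ((-(π ^ 3 / 2 * symE3 b * (atomA0 b).im) : ℝ) : ℂ)]

/-- The jet vector `(a₀, a₁, I)` as a `Fin 3`-indexed family. [cite: Zhang2022LandauSiegel, Prop 7.1 p.44 with (8.11)–(8.23)] -/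
def jetVec (a₀ a₁ Ig : ℂ) : Fin 3 → ℂ := ![a₀, a₁, Ig]

section Entries

variable (b : Fin 3 → ℝ)

/-- Entry `(0,0)`. [cite: Zhang2022LandauSiegel, Prop 7.1 p.44 with (8.11)–(8.23)] -/
@[simp] theorem jetMat_00 : jetMat b 0 0 = ((π * jetKappa b : ℝ) : ℂ) := rfl
/-- Entry `(0,1)`. [cite: Zhang2022LandauSiegel, Prop 7.1 p.44 with (8.11)–(8.23)] -/
@[simp] theorem jetMat_01 : jetMat b 0 1 = I * π * conj (jetY b) / 2 := rfl
/-- Entry `(0,2)`. [cite: Zhang2022LandauSiegel, Prop 7.1 p.44 with (8.11)–(8.23)] -/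
@[simp] theorem jetMat_02 : jetMat b 0 2 = -(π : ℂ) ^ 2 * conj (atomAN b) / 2 := rfl
/-- Entry `(1,0)`. [cite: Zhang2022LandauSiegel, Prop 7.1 p.44 with (8.11)–(8.23)] -/
@[simp] theorem jetMat_10 : jetMat b 1 0 = -(I * π * jetY b) / 2 := rfl
/-- Entry `(1,1)`. [cite: Zhang2022LandauSiegel, Prop 7.1 p.44 with (8.11)–(8.23)] -/
@[simp] theorem jetMat_11 : jetMat b 1 1 = ((π * jetKappa b : ℝ) : ℂ) := rfl
/-- Entry `(1,2)`. [cite: Zhang2022LandauSiegel, Prop 7.1 p.44 with (8.11)–(8.23)] -/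
@[simp] theorem jetMat_12 : jetMat b 1 2 = -(π : ℂ) ^ 2 * atomAN b / 2 := rfl
/-- Entry `(2,0)`. [cite: Zhang2022LandauSiegel, Prop 7.1 p.44 with (8.11)–(8.23)] -/
@[simp] theorem jetMat_20 : jetMat b 2 0 = -(π : ℂ) ^ 2 * atomAN b / 2 := rfl
/-- Entry `(2,1)`. [cite: Zhang2022LandauSiegel, Prop 7.1 p.44 with (8.11)–(8.23)] -/
@[simp] theorem jetMat_21 : jetMat b 2 1 = -(π : ℂ) ^ 2 * conj (atomAN b) / 2 := rfl
/-- Entry `(2,2)`. [cite: Zhang2022LandauSiegel, Prop 7.1 p.44 with (8.11)–(8.23)] -/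
@[simp] theorem jetMat_22 : jetMat b 2 2 = ((-(π ^ 3 / 2 * symE3 b * (atomA0 b).im) : ℝ) : ℂ) := rfl
/-- Component `0` of the jet vector. [cite: Zhang2022LandauSiegel, Prop 7.1 p.44 with (8.11)–(8.23)] -/
@[simp] theorem jetVec_0 (a₀ a₁ Ig : ℂ) : jetVec a₀ a₁ Ig 0 = a₀ := rfl
/-- Component `1` of the jet vector. [cite: Zhang2022LandauSiegel, Prop 7.1 p.44 with (8.11)–(8.23)] -/
@[simp] theorem jetVec_1 (a₀ a₁ Ig : ℂ) : jetVec a₀ a₁ Ig 1 = a₁ := rfl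
/-- Component `2` of the jet vector. [cite: Zhang2022LandauSiegel, Prop 7.1 p.44 with (8.11)–(8.23)] -/
@[simp] theorem jetVec_2 (a₀ a₁ Ig : ℂ) : jetVec a₀ a₁ Ig 2 = Ig := rfl

/-- The jet matrix is Hermitian (entrywise `conj m_{ij} = m_{ji}`). [cite: Zhang2022LandauSiegel, Prop 7.1 p.44 with (8.11)–(8.23)] -/
theorem jetMat_conj (i j : Fin 3) : conj (jetMat b i j) = jetMat b j i := by
  fin_cases i <;> fin_cases j <;>
    simp [jetMat, Matrix.of_apply, Matrix.cons_val_zero, Matrix.cons_val_one, Matrix.cons_val,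
      Complex.conj_ofReal, map_div₀, map_mul, map_neg, map_ofNat, Complex.conj_I]

/-- Its trace is `λ_b = Det.jetTrace b`. [cite: Zhang2022LandauSiegel, Prop 7.1 p.44 with (8.11)–(8.23)] -/
theorem jetMat_trace : jetMat b 0 0 + jetMat b 1 1 + jetMat b 2 2 = ((jetTrace b : ℝ) : ℂ) := by
  simp only [jetMat_00, jetMat_11, jetMat_22, jetTrace]
  push_cast
  ring

/-- The pairwise differences of a pairwise distinct triple are non-zero (as complex numbers). [folklore] -/
private theorem sub_casts_ne_zero (h01 : b 0 ≠ b 1) (h02 : b 0 ≠ b 2) (h12 : b 1 ≠ b 2) :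
    ((b 0 : ℝ) : ℂ) - (b 1 : ℂ) ≠ 0 ∧ ((b 0 : ℝ) : ℂ) - (b 2 : ℂ) ≠ 0 ∧ ((b 1 : ℝ) : ℂ) - (b 2 : ℂ) ≠ 0 ∧
      ((b 1 : ℝ) : ℂ) - (b 0 : ℂ) ≠ 0 ∧ ((b 2 : ℝ) : ℂ) - (b 0 : ℂ) ≠ 0 ∧ ((b 2 : ℝ) : ℂ) - (b 1 : ℂ) ≠ 0 := by
  refine ⟨?_, ?_, ?_, ?_, ?_, ?_⟩
  · rw [sub_ne_zero]; exact_mod_cast h01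
  · rw [sub_ne_zero]; exact_mod_cast h02
  · rw [sub_ne_zero]; exact_mod_cast h12
  · rw [sub_ne_zero]; exact_mod_cast (Ne.symm h01)
  · rw [sub_ne_zero]; exact_mod_cast (Ne.symm h02)
  · rw [sub_ne_zero]; exact_mod_cast (Ne.symm h12)

end Entries

/-! ### Part 1 — K1‴'s apex block IS the Hermitian form of the jet matrix -/

/-- **`J_b(v) = v* M_b v`:** K1‴'s apex block `freeEndForm b I (−a₀) + freeEndForm b 0 (−conj a₁) + π·Re crossJet b a₀ a₁ I`
equals `Σ_{r,c} conj(v_r)·(M_b)_{rc}·v_c` at `v = (a₀, a₁, I)` (as a complex number: the right side is real).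
[cite: Zhang2022LandauSiegel, Prop 7.1 p.44 with (8.11)–(8.23); §18 (18.1)] -/
theorem jetForm_eq_jetMat (b : Fin 3 → ℝ) (a₀ a₁ Ig : ℂ) :
    ((freeEndForm b Ig (-a₀) + freeEndForm b 0 (-conj a₁) + π * (crossJet b a₀ a₁ Ig).re : ℝ) : ℂ)
      = ∑ r : Fin 3, ∑ c : Fin 3, conj (jetVec a₀ a₁ Ig r) * jetMat b r c * jetVec a₀ a₁ Ig c := by
  have hcj : crossJet b a₀ a₁ Ig = -I * jetY b * a₀ * conj a₁ - π * atomAN b * Ig * conj a₁ := rfl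
  simp only [Fin.sum_univ_three, jetVec_0, jetVec_1, jetVec_2, jetMat_00, jetMat_01, jetMat_02, jetMat_10,
    jetMat_11, jetMat_12, jetMat_20, jetMat_21, jetMat_22, freeEndForm, hcj, jetKappa, symE1, symE3]
  set Y : ℂ := jetY b
  set N : ℂ := atomAN b
  apply Complex.ext
  · simp only [Complex.ofReal_re, Complex.add_re, Complex.sub_re, Complex.mul_re, Complex.neg_re,
      Complex.div_ofNat_re, Complex.mul_im, Complex.neg_im, Complex.div_ofNat_im,
      Complex.conj_re, Complex.conj_im, Complex.ofReal_im, Complex.I_re, Complex.I_im, norm_neg, Complex.norm_conj,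
      norm_zero, Complex.zero_re, Complex.zero_im, Complex.sq_norm, Complex.normSq_apply]
    simp only [pow_succ, pow_zero, one_mul, Complex.ofReal_re, Complex.ofReal_im, Complex.mul_re, Complex.mul_im]
    ring
  · simp only [Complex.ofReal_im, Complex.add_im, Complex.mul_im, Complex.neg_im,
      Complex.div_ofNat_im, Complex.sub_re, Complex.mul_re, Complex.neg_re, Complex.div_ofNat_re,
      Complex.conj_re, Complex.conj_im, Complex.ofReal_re, Complex.I_re, Complex.I_im, norm_neg, Complex.norm_conj,
      norm_zero, Complex.zero_re, Complex.zero_im, Complex.sq_norm, Complex.normSq_apply]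
    simp only [pow_succ, pow_zero, one_mul, Complex.ofReal_re, Complex.ofReal_im, Complex.mul_re, Complex.mul_im]
    ring

/-- The same as a single sum against the matrix–vector product: `J_b(v) = Σ_r conj(v_r)·(M_b v)_r`.
[cite: Zhang2022LandauSiegel, Prop 7.1 p.44 with (8.11)–(8.23)] -/
theorem jetForm_eq_sum_mulVec (b : Fin 3 → ℝ) (a₀ a₁ Ig : ℂ) :
    ((freeEndForm b Ig (-a₀) + freeEndForm b 0 (-conj a₁) + π * (crossJet b a₀ a₁ Ig).re : ℝ) : ℂ)
      = ∑ r : Fin 3, conj (jetVec a₀ a₁ Ig r) * ∑ c : Fin 3, jetMat b r c * jetVec a₀ a₁ Ig c := by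
  rw [jetForm_eq_jetMat]
  refine Finset.sum_congr rfl fun r _ => ?_
  rw [Finset.mul_sum]
  refine Finset.sum_congr rfl fun c _ => ?_
  ring

/-! ### Part 2 — every `2 × 2` minor of the jet matrix is a multiple of `c₀(b) = Re A₀(b)` -/

section Minors

variable (b : Fin 3 → ℝ)

/-- `Y_b = A_{N/b}(b) − u₀u₁u₂` for a triple with non-zero entries (`Det.sum_shiftGlueW_eq_atomG`,
`Det.shiftGlue0_eq_neg_halfUnit_prod`). [cite: Zhang2022LandauSiegel, Prop 14.1; Lemma 15.1; §18 (18.1)] -/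
theorem jetY_eq_atomG_sub (hb0 : ∀ j, b j ≠ 0) :
    jetY b = atomG b - halfUnit b 0 * halfUnit b 1 * halfUnit b 2 := by
  rw [jetY, sum_shiftGlueW_eq_atomG hb0, shiftGlue0_eq_neg_halfUnit_prod]
  ring

/-- `I⁴ = 1`. [folklore] -/
private theorem I_pow_four' : (I : ℂ) ^ 4 = 1 := by
  rw [show (4:ℕ) = 2 + 2 from rfl, pow_add, Complex.I_sq]; ring

/-- `conj(u₀u₁u₂) = (u₀u₁u₂)⁻¹`. [folklore] -/
private theorem conj_halfUnit_prod :
    conj (halfUnit b 0 * halfUnit b 1 * halfUnit b 2) = (halfUnit b 0 * halfUnit b 1 * halfUnit b 2)⁻¹ := by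
  simp only [map_mul, conj_halfUnit, mul_inv]

/-- `A₀` as ONE fraction over `D = 2u₀u₁u₂(b₀−b₁)(b₀−b₂)(b₁−b₂)`. [cite: Zhang2022LandauSiegel, §7 Prop. 7.1 p.44, (7.19)–(7.21)] -/
theorem atomA0_closed (h01 : b 0 ≠ b 1) (h02 : b 0 ≠ b 2) (h12 : b 1 ≠ b 2) :
    atomA0 b = (2 * (b 0 : ℂ) * ((b 1 : ℂ) - (b 2 : ℂ)) * halfUnit b 1 ^ 2 * halfUnit b 2 ^ 2
      - 2 * (b 1 : ℂ) * ((b 0 : ℂ) - (b 2 : ℂ)) * halfUnit b 0 ^ 2 * halfUnit b 2 ^ 2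
      + 2 * (b 2 : ℂ) * ((b 0 : ℂ) - (b 1 : ℂ)) * halfUnit b 0 ^ 2 * halfUnit b 1 ^ 2) / dblD b := by
  have hD := dblD_ne_zero b h01 h02 h12
  have hu0 := halfUnit_ne_zero b 0; have hu1 := halfUnit_ne_zero b 1; have hu2 := halfUnit_ne_zero b 2
  obtain ⟨h01', h02', h12', h10', h20', h21'⟩ := sub_casts_ne_zero b h01 h02 h12
  rw [atomA0_halfUnit]
  unfold dblD at hD ⊢
  push_cast at hD ⊢
  field_simp
  ring

/-- `conj A₀` as ONE fraction over `D`. [cite: Zhang2022LandauSiegel, §7 Prop. 7.1 p.44, (7.19)–(7.21)] -/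
theorem conj_atomA0_closed (h01 : b 0 ≠ b 1) (h02 : b 0 ≠ b 2) (h12 : b 1 ≠ b 2) :
    conj (atomA0 b) = (2 * (b 0 : ℂ) * ((b 1 : ℂ) - (b 2 : ℂ)) * halfUnit b 0 ^ 2
      - 2 * (b 1 : ℂ) * ((b 0 : ℂ) - (b 2 : ℂ)) * halfUnit b 1 ^ 2
      + 2 * (b 2 : ℂ) * ((b 0 : ℂ) - (b 1 : ℂ)) * halfUnit b 2 ^ 2) / dblD b := by
  have hD := dblD_ne_zero b h01 h02 h12
  have hu0 := halfUnit_ne_zero b 0; have hu1 := halfUnit_ne_zero b 1; have hu2 := halfUnit_ne_zero b 2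
  obtain ⟨h01', h02', h12', h10', h20', h21'⟩ := sub_casts_ne_zero b h01 h02 h12
  rw [conj_atomA0_halfUnit]
  unfold dblD at hD ⊢
  push_cast at hD ⊢
  field_simp
  ring

/-- `A_b` as ONE fraction over `D`. [cite: Zhang2022LandauSiegel, §7 Prop. 7.1 p.44, (7.19)–(7.21)] -/
theorem atomAb_closed (h01 : b 0 ≠ b 1) (h02 : b 0 ≠ b 2) (h12 : b 1 ≠ b 2) :
    atomAb b = (2 * (b 0 : ℂ) ^ 2 * ((b 1 : ℂ) - (b 2 : ℂ)) * halfUnit b 1 ^ 2 * halfUnit b 2 ^ 2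
      - 2 * (b 1 : ℂ) ^ 2 * ((b 0 : ℂ) - (b 2 : ℂ)) * halfUnit b 0 ^ 2 * halfUnit b 2 ^ 2
      + 2 * (b 2 : ℂ) ^ 2 * ((b 0 : ℂ) - (b 1 : ℂ)) * halfUnit b 0 ^ 2 * halfUnit b 1 ^ 2) / dblD b := by
  have hD := dblD_ne_zero b h01 h02 h12
  have hu0 := halfUnit_ne_zero b 0; have hu1 := halfUnit_ne_zero b 1; have hu2 := halfUnit_ne_zero b 2
  obtain ⟨h01', h02', h12', h10', h20', h21'⟩ := sub_casts_ne_zero b h01 h02 h12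
  rw [atomAb_halfUnit]
  unfold dblD at hD ⊢
  push_cast at hD ⊢
  field_simp
  ring

/-- `conj A_b` as ONE fraction over `D`. [cite: Zhang2022LandauSiegel, §7 Prop. 7.1 p.44, (7.19)–(7.21)] -/
theorem conj_atomAb_closed (h01 : b 0 ≠ b 1) (h02 : b 0 ≠ b 2) (h12 : b 1 ≠ b 2) :
    conj (atomAb b) = (2 * (b 0 : ℂ) ^ 2 * ((b 1 : ℂ) - (b 2 : ℂ)) * halfUnit b 0 ^ 2
      - 2 * (b 1 : ℂ) ^ 2 * ((b 0 : ℂ) - (b 2 : ℂ)) * halfUnit b 1 ^ 2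
      + 2 * (b 2 : ℂ) ^ 2 * ((b 0 : ℂ) - (b 1 : ℂ)) * halfUnit b 2 ^ 2) / dblD b := by
  have hD := dblD_ne_zero b h01 h02 h12
  have hu0 := halfUnit_ne_zero b 0; have hu1 := halfUnit_ne_zero b 1; have hu2 := halfUnit_ne_zero b 2
  obtain ⟨h01', h02', h12', h10', h20', h21'⟩ := sub_casts_ne_zero b h01 h02 h12
  rw [conj_atomAb_halfUnit]
  unfold dblD at hD ⊢
  push_cast at hD ⊢
  field_simp
  ring

/-- `A_{N/b} = Σ_j N_j ω_j` as ONE fraction over `D`. [cite: Zhang2022LandauSiegel, Lemma 15.1; §8 (8.13)–(8.18)] -/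
theorem atomG_closed (h01 : b 0 ≠ b 1) (h02 : b 0 ≠ b 2) (h12 : b 1 ≠ b 2) :
    atomG b = (2 * ((b 1 : ℂ) * (b 2 : ℂ)) * ((b 1 : ℂ) - (b 2 : ℂ)) * halfUnit b 1 ^ 2 * halfUnit b 2 ^ 2
      - 2 * ((b 0 : ℂ) * (b 2 : ℂ)) * ((b 0 : ℂ) - (b 2 : ℂ)) * halfUnit b 0 ^ 2 * halfUnit b 2 ^ 2
      + 2 * ((b 0 : ℂ) * (b 1 : ℂ)) * ((b 0 : ℂ) - (b 1 : ℂ)) * halfUnit b 0 ^ 2 * halfUnit b 1 ^ 2) / dblD b := by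
  have hD := dblD_ne_zero b h01 h02 h12
  have hu0 := halfUnit_ne_zero b 0; have hu1 := halfUnit_ne_zero b 1; have hu2 := halfUnit_ne_zero b 2
  obtain ⟨h01', h02', h12', h10', h20', h21'⟩ := sub_casts_ne_zero b h01 h02 h12
  rw [atomG_halfUnit]
  unfold dblD at hD ⊢
  push_cast at hD ⊢
  field_simp
  ring

/-- `conj A_{N/b}` as ONE fraction over `D`. [cite: Zhang2022LandauSiegel, Lemma 15.1; §8 (8.13)–(8.18)] -/
theorem conj_atomG_closed (h01 : b 0 ≠ b 1) (h02 : b 0 ≠ b 2) (h12 : b 1 ≠ b 2) :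
    conj (atomG b) = (2 * ((b 1 : ℂ) * (b 2 : ℂ)) * ((b 1 : ℂ) - (b 2 : ℂ)) * halfUnit b 0 ^ 2
      - 2 * ((b 0 : ℂ) * (b 2 : ℂ)) * ((b 0 : ℂ) - (b 2 : ℂ)) * halfUnit b 1 ^ 2
      + 2 * ((b 0 : ℂ) * (b 1 : ℂ)) * ((b 0 : ℂ) - (b 1 : ℂ)) * halfUnit b 2 ^ 2) / dblD b := by
  have hD := dblD_ne_zero b h01 h02 h12
  have hu0 := halfUnit_ne_zero b 0; have hu1 := halfUnit_ne_zero b 1; have hu2 := halfUnit_ne_zero b 2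
  obtain ⟨h01', h02', h12', h10', h20', h21'⟩ := sub_casts_ne_zero b h01 h02 h12
  rw [atomG_halfUnit]
  simp only [map_add, map_mul, map_div₀, Complex.conj_ofReal, conj_halfUnit]
  unfold dblD at hD ⊢
  push_cast at hD ⊢
  field_simp
  ring

set_option maxRecDepth 20000 in
/-- **Minor `(a₀,a₁ | a₀,a₁)`:** `m₀₀m₁₁ − m₀₁m₁₀ = π²(κ² − |Y|²/4) = c₀·π²((e₂ − e₁²/4)·c₀ − Re A_N)` — equivalently the
global identity `|Σ_jW′_j + c_g|² = 4κ² + 4c₀(Re A_N − (e₂ − e₁²/4)c₀)`.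
[cite: Zhang2022LandauSiegel, Prop 7.1 p.44 with (8.11)–(8.23); Lemma 15.1; §18 (18.1)] -/
theorem jetMat_minor_01_01 (h01 : b 0 ≠ b 1) (h02 : b 0 ≠ b 2) (h12 : b 1 ≠ b 2) (hb0 : ∀ j, b j ≠ 0) :
    jetMat b 0 0 * jetMat b 1 1 - jetMat b 0 1 * jetMat b 1 0
      = ((atomA0 b).re : ℂ) * ((π : ℂ) ^ 2 * ((((b 0 * b 1 + b 1 * b 2 + b 2 * b 0 : ℝ) : ℂ)
          - ((b 0 + b 1 + b 2 : ℝ) : ℂ) ^ 2 / 4) * ((atomA0 b).re : ℂ) - ((atomAN b).re : ℂ))) := by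
  have hD := dblD_ne_zero b h01 h02 h12
  have hu0 := halfUnit_ne_zero b 0; have hu1 := halfUnit_ne_zero b 1; have hu2 := halfUnit_ne_zero b 2
  have hI : (I : ℂ) ≠ 0 := Complex.I_ne_zero
  obtain ⟨h01', h02', h12', -, -, -⟩ := sub_casts_ne_zero b h01 h02 h12
  simp only [jetMat_00, jetMat_11, jetMat_01, jetMat_10, jetKappa, symE1, jetY_eq_atomG_sub b hb0, map_sub,
    conj_halfUnit_prod]
  push_cast
  rw [Complex.re_eq_add_conj (atomAN b), re_atomA0_closed b h01 h02 h12, im_atomA0_closed b h01 h02 h12,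
    im_atomAb_closed b h01 h02 h12, conj_atomAN_closed b h01 h02 h12, atomAN_closed b h01 h02 h12,
    conj_atomG_closed b h01 h02 h12, atomG_closed b h01 h02 h12]
  unfold dblD at hD ⊢
  push_cast at hD ⊢
  field_simp
  ring_nf
  simp only [Complex.I_sq, I_pow_four']
  ring_nf

/-- **Minor `(a₀,I | a₀,I)`:** `m₀₀m₂₂ − m₀₂m₂₀ = c₀·(π⁴e₃/4)(2Re A_b − e₁c₀)` (equivalently ls-num-2's global identity `|A_N|² = e₃(e₁|A₀|² − 2Re(A_b·conj A₀))`). [cite: Zhang2022LandauSiegel, Prop 7.1 p.44 with (8.11)–(8.23); §8 (8.13)–(8.18)] -/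
theorem jetMat_minor_02_02 (h01 : b 0 ≠ b 1) (h02 : b 0 ≠ b 2) (h12 : b 1 ≠ b 2) :
    jetMat b 0 0 * jetMat b 2 2 - jetMat b 0 2 * jetMat b 2 0
      = ((atomA0 b).re : ℂ) * ((π : ℂ) ^ 4 * ((b 0 * b 1 * b 2 : ℝ) : ℂ) / 4
          * (2 * ((atomAb b).re : ℂ) - ((b 0 + b 1 + b 2 : ℝ) : ℂ) * ((atomA0 b).re : ℂ))) := by
  have hD := dblD_ne_zero b h01 h02 h12
  have hu0 := halfUnit_ne_zero b 0; have hu1 := halfUnit_ne_zero b 1; have hu2 := halfUnit_ne_zero b 2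
  have hI : (I : ℂ) ≠ 0 := Complex.I_ne_zero
  obtain ⟨h01', h02', h12', -, -, -⟩ := sub_casts_ne_zero b h01 h02 h12
  simp only [jetMat_00, jetMat_22, jetMat_02, jetMat_20, jetKappa, symE1, symE3]
  push_cast
  rw [im_atomAb_closed b h01 h02 h12, Complex.re_eq_add_conj (atomAb b), re_atomA0_closed b h01 h02 h12, im_atomA0_closed b h01 h02 h12, conj_atomAN_closed b h01 h02 h12, atomAN_closed b h01 h02 h12, conj_atomAb_closed b h01 h02 h12, atomAb_closed b h01 h02 h12]
  unfold dblD at hD ⊢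
  push_cast at hD ⊢
  field_simp
  ring_nf
  simp only [Complex.I_sq]
  ring_nf

/-- **Minor `(a₁,I | a₁,I)`:** `m₁₁m₂₂ − m₁₂m₂₁ = c₀·(π⁴e₃/4)(2Re A_b − e₁c₀)` (the same value as the `(a₀,I)` minor). [cite: Zhang2022LandauSiegel, Prop 7.1 p.44 with (8.11)–(8.23); §8 (8.13)–(8.18)] -/
theorem jetMat_minor_12_12 (h01 : b 0 ≠ b 1) (h02 : b 0 ≠ b 2) (h12 : b 1 ≠ b 2) :
    jetMat b 1 1 * jetMat b 2 2 - jetMat b 1 2 * jetMat b 2 1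
      = ((atomA0 b).re : ℂ) * ((π : ℂ) ^ 4 * ((b 0 * b 1 * b 2 : ℝ) : ℂ) / 4
          * (2 * ((atomAb b).re : ℂ) - ((b 0 + b 1 + b 2 : ℝ) : ℂ) * ((atomA0 b).re : ℂ))) := by
  have hD := dblD_ne_zero b h01 h02 h12
  have hu0 := halfUnit_ne_zero b 0; have hu1 := halfUnit_ne_zero b 1; have hu2 := halfUnit_ne_zero b 2
  have hI : (I : ℂ) ≠ 0 := Complex.I_ne_zero
  obtain ⟨h01', h02', h12', -, -, -⟩ := sub_casts_ne_zero b h01 h02 h12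
  simp only [jetMat_11, jetMat_22, jetMat_12, jetMat_21, jetKappa, symE1, symE3]
  push_cast
  rw [im_atomAb_closed b h01 h02 h12, Complex.re_eq_add_conj (atomAb b), re_atomA0_closed b h01 h02 h12, im_atomA0_closed b h01 h02 h12, conj_atomAN_closed b h01 h02 h12, atomAN_closed b h01 h02 h12, conj_atomAb_closed b h01 h02 h12, atomAb_closed b h01 h02 h12]
  unfold dblD at hD ⊢
  push_cast at hD ⊢
  field_simp
  ring_nf
  simp only [Complex.I_sq]
  ring_nf

set_option maxRecDepth 20000 in
/-- **Minor `(a₀,a₁ | a₀,I)`:** `m₀₀m₁₂ − m₀₂m₁₀ = c₀·(iπ³/2)(e₃A₀ − (e₁/2)A_N)`. [cite: Zhang2022LandauSiegel, Prop 7.1 p.44 with (8.11)–(8.23); Lemma 15.1; §18 (18.1)] -/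
theorem jetMat_minor_01_02 (h01 : b 0 ≠ b 1) (h02 : b 0 ≠ b 2) (h12 : b 1 ≠ b 2) (hb0 : ∀ j, b j ≠ 0) :
    jetMat b 0 0 * jetMat b 1 2 - jetMat b 0 2 * jetMat b 1 0
      = ((atomA0 b).re : ℂ) * (I * (π : ℂ) ^ 3 / 2
          * (((b 0 * b 1 * b 2 : ℝ) : ℂ) * atomA0 b - ((b 0 + b 1 + b 2 : ℝ) : ℂ) / 2 * atomAN b)) := by
  have hD := dblD_ne_zero b h01 h02 h12
  have hu0 := halfUnit_ne_zero b 0; have hu1 := halfUnit_ne_zero b 1; have hu2 := halfUnit_ne_zero b 2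
  have hI : (I : ℂ) ≠ 0 := Complex.I_ne_zero
  obtain ⟨h01', h02', h12', -, -, -⟩ := sub_casts_ne_zero b h01 h02 h12
  simp only [jetMat_00, jetMat_12, jetMat_02, jetMat_10, jetKappa, symE1, jetY_eq_atomG_sub b hb0]
  push_cast
  rw [re_atomA0_closed b h01 h02 h12, im_atomA0_closed b h01 h02 h12, im_atomAb_closed b h01 h02 h12, conj_atomAN_closed b h01 h02 h12, atomAN_closed b h01 h02 h12, atomG_closed b h01 h02 h12, atomA0_closed b h01 h02 h12]
  unfold dblD at hD ⊢
  push_cast at hD ⊢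
  field_simp
  ring_nf
  simp only [Complex.I_sq]
  ring_nf

set_option maxRecDepth 20000 in
/-- **Minor `(a₀,a₁ | a₁,I)`:** `m₀₁m₁₂ − m₀₂m₁₁ = c₀·(iπ³/2)(e₃·conj A₀ − (e₁/2)·conj A_N)`. [cite: Zhang2022LandauSiegel, Prop 7.1 p.44 with (8.11)–(8.23); Lemma 15.1; §18 (18.1)] -/
theorem jetMat_minor_01_12 (h01 : b 0 ≠ b 1) (h02 : b 0 ≠ b 2) (h12 : b 1 ≠ b 2) (hb0 : ∀ j, b j ≠ 0) :
    jetMat b 0 1 * jetMat b 1 2 - jetMat b 0 2 * jetMat b 1 1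
      = ((atomA0 b).re : ℂ) * (I * (π : ℂ) ^ 3 / 2
          * (((b 0 * b 1 * b 2 : ℝ) : ℂ) * conj (atomA0 b) - ((b 0 + b 1 + b 2 : ℝ) : ℂ) / 2 * conj (atomAN b))) := by
  have hD := dblD_ne_zero b h01 h02 h12
  have hu0 := halfUnit_ne_zero b 0; have hu1 := halfUnit_ne_zero b 1; have hu2 := halfUnit_ne_zero b 2
  have hI : (I : ℂ) ≠ 0 := Complex.I_ne_zero
  obtain ⟨h01', h02', h12', -, -, -⟩ := sub_casts_ne_zero b h01 h02 h12
  simp only [jetMat_01, jetMat_12, jetMat_02, jetMat_11, jetKappa, symE1, jetY_eq_atomG_sub b hb0, map_sub,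
    conj_halfUnit_prod]
  push_cast
  rw [re_atomA0_closed b h01 h02 h12, im_atomA0_closed b h01 h02 h12, im_atomAb_closed b h01 h02 h12, conj_atomAN_closed b h01 h02 h12, atomAN_closed b h01 h02 h12, conj_atomG_closed b h01 h02 h12, conj_atomA0_closed b h01 h02 h12]
  unfold dblD at hD ⊢
  push_cast at hD ⊢
  field_simp
  ring_nf
  simp only [Complex.I_sq]
  ring_nf

/-- **Minor `(a₀,I | a₁,I)`:** `m₀₁m₂₂ − m₀₂m₂₁ = −c₀·(π⁴e₃/4)·conj(A_{N/b} + u₀u₁u₂)` (`A_{N/b} = Det.atomG`, `u_m = Det.halfUnit`; note `A_{N/b} + u₀u₁u₂ = Y + 2u₀u₁u₂`). [cite: Zhang2022LandauSiegel, Prop 7.1 p.44 with (8.11)–(8.23); Lemma 15.1; §18 (18.1)] -/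
theorem jetMat_minor_02_12 (h01 : b 0 ≠ b 1) (h02 : b 0 ≠ b 2) (h12 : b 1 ≠ b 2) (hb0 : ∀ j, b j ≠ 0) :
    jetMat b 0 1 * jetMat b 2 2 - jetMat b 0 2 * jetMat b 2 1
      = -((atomA0 b).re : ℂ) * ((π : ℂ) ^ 4 * ((b 0 * b 1 * b 2 : ℝ) : ℂ) / 4
          * conj (atomG b + halfUnit b 0 * halfUnit b 1 * halfUnit b 2)) := by
  have hD := dblD_ne_zero b h01 h02 h12
  have hu0 := halfUnit_ne_zero b 0; have hu1 := halfUnit_ne_zero b 1; have hu2 := halfUnit_ne_zero b 2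
  have hI : (I : ℂ) ≠ 0 := Complex.I_ne_zero
  obtain ⟨h01', h02', h12', -, -, -⟩ := sub_casts_ne_zero b h01 h02 h12
  simp only [jetMat_01, jetMat_22, jetMat_02, jetMat_21, symE3, jetY_eq_atomG_sub b hb0, map_sub, map_add,
    conj_halfUnit_prod]
  push_cast
  rw [re_atomA0_closed b h01 h02 h12, im_atomA0_closed b h01 h02 h12, conj_atomAN_closed b h01 h02 h12, conj_atomG_closed b h01 h02 h12]
  unfold dblD at hD ⊢
  push_cast at hD ⊢
  field_simp
  ring_nf

end Minors

/-! ### Part 3 — on the hypersurface `c₀(b) = 0`: all minors vanish, `M_b` has rank `≤ 1` -/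

section RankOne

variable (b : Fin 3 → ℝ)

/-- Pure `3 × 3` algebra (Cayley–Hamilton, `tr M·M − M² = e₂(M)·1 − adj M`): if all nine `2 × 2` minors of `m`
vanish then `(wᵀ m v)·tr m = Σ_r (m v)_r·(mᵀ w)_r` for all vectors `v, w`. [folklore] -/
private theorem sum_mul_trace_eq_of_minors_eq_zero (m : Fin 3 → Fin 3 → ℂ) (v w : Fin 3 → ℂ)
    (h1 : m 0 0 * m 1 1 - m 0 1 * m 1 0 = 0) (h2 : m 0 0 * m 2 2 - m 0 2 * m 2 0 = 0)
    (h3 : m 1 1 * m 2 2 - m 1 2 * m 2 1 = 0) (h4 : m 0 0 * m 1 2 - m 0 2 * m 1 0 = 0)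
    (h5 : m 0 1 * m 1 2 - m 0 2 * m 1 1 = 0) (h6 : m 0 1 * m 2 2 - m 0 2 * m 2 1 = 0)
    (h7 : m 0 0 * m 2 1 - m 0 1 * m 2 0 = 0) (h8 : m 1 0 * m 2 1 - m 1 1 * m 2 0 = 0)
    (h9 : m 1 0 * m 2 2 - m 1 2 * m 2 0 = 0) :
    (∑ r : Fin 3, ∑ c : Fin 3, w r * m r c * v c) * (m 0 0 + m 1 1 + m 2 2)
      = ∑ r : Fin 3, (∑ c : Fin 3, m r c * v c) * (∑ c : Fin 3, m c r * w c) := by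
  simp only [Fin.sum_univ_three]
  linear_combination (w 0 * v 0 + w 1 * v 1 + w 2 * v 2) * (h1 + h2 + h3) - (w 0 * v 0) * h3 - (w 1 * v 1) * h2
    - (w 2 * v 2) * h1 + (w 0 * v 1) * h6 + (w 1 * v 0) * h9 - (w 0 * v 2) * h5 - (w 2 * v 0) * h8
    + (w 1 * v 2) * h4 + (w 2 * v 1) * h7

/-- First-row version: `m₀₀·(wᵀ m v) = (m v)₀·(mᵀ w)₀` from the four minors through `m₀₀`. [folklore] -/
private theorem entry_mul_sum_eq_of_minors_eq_zero (m : Fin 3 → Fin 3 → ℂ) (v w : Fin 3 → ℂ)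
    (h1 : m 0 0 * m 1 1 - m 0 1 * m 1 0 = 0) (h2 : m 0 0 * m 2 2 - m 0 2 * m 2 0 = 0)
    (h4 : m 0 0 * m 1 2 - m 0 2 * m 1 0 = 0) (h7 : m 0 0 * m 2 1 - m 0 1 * m 2 0 = 0) :
    m 0 0 * (∑ r : Fin 3, ∑ c : Fin 3, w r * m r c * v c)
      = (∑ c : Fin 3, m 0 c * v c) * (∑ r : Fin 3, m r 0 * w r) := by
  simp only [Fin.sum_univ_three]
  linear_combination (w 1 * v 1) * h1 + (w 2 * v 2) * h2 + (w 1 * v 2) * h4 + (w 2 * v 1) * h7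

/-- **RANK ONE ON THE LOCUS: if `c₀(b) = Re A₀(b) = 0` (pairwise distinct `b`, `b_j ≠ 0`) then ALL `2 × 2` minors of
the jet matrix vanish** — `M_b` has rank `≤ 1`. [cite: Zhang2022LandauSiegel, Prop 7.1 p.44 with (8.11)–(8.23); Lemma 15.1; §18 (18.1)] -/
theorem jetMat_minors_eq_zero (h01 : b 0 ≠ b 1) (h02 : b 0 ≠ b 2) (h12 : b 1 ≠ b 2) (hb0 : ∀ j, b j ≠ 0)
    (hc : (atomA0 b).re = 0) (i j k l : Fin 3) :
    jetMat b i k * jetMat b j l - jetMat b i l * jetMat b j k = 0 := by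
  have e1 := jetMat_minor_01_01 b h01 h02 h12 hb0
  have e2 := jetMat_minor_02_02 b h01 h02 h12
  have e3 := jetMat_minor_12_12 b h01 h02 h12
  have e4 := jetMat_minor_01_02 b h01 h02 h12 hb0
  have e5 := jetMat_minor_01_12 b h01 h02 h12 hb0
  have e6 := jetMat_minor_02_12 b h01 h02 h12 hb0
  rw [hc] at e1 e2 e3 e4 e5 e6
  simp only [Complex.ofReal_zero, zero_mul, neg_zero] at e1 e2 e3 e4 e5 e6
  have e7 : jetMat b 0 0 * jetMat b 2 1 - jetMat b 0 1 * jetMat b 2 0 = 0 := by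
    have h := congrArg conj e4
    simp only [map_sub, map_mul, map_zero, jetMat_conj] at h
    linear_combination h
  have e8 : jetMat b 1 0 * jetMat b 2 1 - jetMat b 1 1 * jetMat b 2 0 = 0 := by
    have h := congrArg conj e5
    simp only [map_sub, map_mul, map_zero, jetMat_conj] at h
    linear_combination h
  have e9 : jetMat b 1 0 * jetMat b 2 2 - jetMat b 1 2 * jetMat b 2 0 = 0 := by
    have h := congrArg conj e6
    simp only [map_sub, map_mul, map_zero, jetMat_conj] at h
    linear_combination h
  fin_cases i <;> fin_cases j <;> fin_cases k <;> fin_cases l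
  all_goals simp only [Fin.zero_eta, Fin.mk_one, Fin.reduceFinMk]
  all_goals
    first
    | ring1
    | linear_combination e1
    | linear_combination -e1
    | linear_combination e2
    | linear_combination -e2
    | linear_combination e3
    | linear_combination -e3
    | linear_combination e4
    | linear_combination -e4
    | linear_combination e5
    | linear_combination -e5
    | linear_combination e6
    | linear_combination -e6
    | linear_combination e7
    | linear_combination -e7
    | linear_combination e8
    | linear_combination -e8
    | linear_combination e9
    | linear_combination -e9

/-- **`λ_b · J_b(v) = ‖M_b v‖²` on the locus** (all jet vectors `v`): the jet form is a rank-one square with the sign of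
its trace `λ_b = Det.jetTrace b`. [cite: Zhang2022LandauSiegel, Prop 7.1 p.44 with (8.11)–(8.23); §18 (18.1)] -/
theorem jetTrace_mul_jetForm (h01 : b 0 ≠ b 1) (h02 : b 0 ≠ b 2) (h12 : b 1 ≠ b 2) (hb0 : ∀ j, b j ≠ 0)
    (hc : (atomA0 b).re = 0) (a₀ a₁ Ig : ℂ) :
    ((jetTrace b : ℝ) : ℂ) * ((freeEndForm b Ig (-a₀) + freeEndForm b 0 (-conj a₁) + π * (crossJet b a₀ a₁ Ig).re : ℝ) : ℂ)
      = ∑ r : Fin 3, ((‖∑ c : Fin 3, jetMat b r c * jetVec a₀ a₁ Ig c‖ ^ 2 : ℝ) : ℂ) := by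
  have hm := jetMat_minors_eq_zero b h01 h02 h12 hb0 hc
  have key := sum_mul_trace_eq_of_minors_eq_zero (jetMat b) (jetVec a₀ a₁ Ig) (fun i => conj (jetVec a₀ a₁ Ig i))
    (hm 0 1 0 1) (hm 0 2 0 2) (hm 1 2 1 2) (hm 0 1 0 2) (hm 0 1 1 2) (hm 0 2 1 2) (hm 0 2 0 1) (hm 1 2 0 1)
    (hm 1 2 0 2)
  rw [jetMat_trace, ← jetForm_eq_jetMat, mul_comm] at key
  rw [key]
  refine Finset.sum_congr rfl fun r _ => ?_
  have hc' : (∑ c : Fin 3, jetMat b c r * conj (jetVec a₀ a₁ Ig c)) = conj (∑ c : Fin 3, jetMat b r c * jetVec a₀ a₁ Ig c) := by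
    rw [map_sum]
    exact Finset.sum_congr rfl fun c _ => by rw [map_mul, jetMat_conj]
  rw [hc', Complex.mul_conj']
  push_cast
  ring

/-- **`πκ_b · J_b(v) = |(M_b v)₀|²` on the locus** — the first-row form of rank one (ls-num-2's explicit square,
`(M_b v)₀ = π(κ_b a₀ + (i/2)·conj Y_b·a₁ − (π/2)·conj A_N·I)`). [cite: Zhang2022LandauSiegel, Prop 7.1 p.44 with (8.11)–(8.23); §18 (18.1)] -/
theorem jetKappa_mul_jetForm (h01 : b 0 ≠ b 1) (h02 : b 0 ≠ b 2) (h12 : b 1 ≠ b 2) (hb0 : ∀ j, b j ≠ 0)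
    (hc : (atomA0 b).re = 0) (a₀ a₁ Ig : ℂ) :
    ((π * jetKappa b : ℝ) : ℂ) * ((freeEndForm b Ig (-a₀) + freeEndForm b 0 (-conj a₁) + π * (crossJet b a₀ a₁ Ig).re : ℝ) : ℂ)
      = ((‖∑ c : Fin 3, jetMat b 0 c * jetVec a₀ a₁ Ig c‖ ^ 2 : ℝ) : ℂ) := by
  have hm := jetMat_minors_eq_zero b h01 h02 h12 hb0 hc
  have key := entry_mul_sum_eq_of_minors_eq_zero (jetMat b) (jetVec a₀ a₁ Ig) (fun i => conj (jetVec a₀ a₁ Ig i))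
    (hm 0 1 0 1) (hm 0 2 0 2) (hm 0 1 0 2) (hm 0 2 0 1)
  rw [jetMat_00, ← jetForm_eq_jetMat] at key
  rw [key]
  have hc' : (∑ r : Fin 3, jetMat b r 0 * conj (jetVec a₀ a₁ Ig r)) = conj (∑ c : Fin 3, jetMat b 0 c * jetVec a₀ a₁ Ig c) := by
    rw [map_sum]
    exact Finset.sum_congr rfl fun c _ => by rw [map_mul, jetMat_conj]
  rw [hc', Complex.mul_conj']
  push_cast
  ring

end RankOne

/-! ### Part 4 — the two-sided shift form on the locus -/

section Locus

variable (b : Fin 3 → ℝ)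

/-- **`λ_b · (π/2)·DictShift_b(G) = ‖M_b (G(0), G(1), ∫₀¹G)‖²` for every kinked profile `G`, on `{c₀(b) = 0}`** —
[K1‴]'s master formula on the locus (`Det.pi_div_two_mul_dictShift_of_re_atomA0_eq_zero`: the bulk drops) and rank one.
[cite: Zhang2022LandauSiegel, §4 (4.1); Prop 7.1 p.44 with (8.11)–(8.23); §18 (18.1)] -/
theorem jetTrace_mul_dictShift (h01 : b 0 ≠ b 1) (h02 : b 0 ≠ b 2) (h12 : b 1 ≠ b 2) (hb0 : ∀ j, b j ≠ 0)
    (hc : (atomA0 b).re = 0) (hG : KinkedProfile G G') :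
    jetTrace b * (π / 2 * DictShift b G G')
      = ∑ r : Fin 3, ‖∑ c : Fin 3, jetMat b r c * jetVec (G 0) (G 1) (∫ y in (0:ℝ)..1, G y) c‖ ^ 2 := by
  have h := jetTrace_mul_jetForm b h01 h02 h12 hb0 hc (G 0) (G 1) (∫ y in (0:ℝ)..1, G y)
  rw [← pi_div_two_mul_dictShift_of_re_atomA0_eq_zero b hc hG] at h
  exact_mod_cast h

/-- **ls-num-2's explicit rank-one form:** on `{c₀(b) = 0}`, for every kinked `G`,
`κ_b·DictShift_b(G) = 2·‖κ_b·G(0) + (i/2)·conj Y_b·G(1) − (π/2)·conj A_N(b)·∫₀¹G‖²` (read-backs: `(2,3,4)` ↦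
`−16‖G0 − G1 − 3πi∫G‖²`, `(1,3,7)` ↦ `2‖G0 + G1‖²`, `(1,2,4)` ↦ `−(16/3)‖G0 − G1 − πi∫G‖²`, the kernel closed forms of
`DetectorDictShiftC0Zero`). [cite: Zhang2022LandauSiegel, §4 (4.1); Prop 7.1 p.44 with (8.11)–(8.23); §18 (18.1)] -/
theorem jetKappa_mul_dictShift (h01 : b 0 ≠ b 1) (h02 : b 0 ≠ b 2) (h12 : b 1 ≠ b 2) (hb0 : ∀ j, b j ≠ 0)
    (hc : (atomA0 b).re = 0) (hG : KinkedProfile G G') :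
    jetKappa b * DictShift b G G'
      = 2 * ‖(jetKappa b : ℂ) * G 0 + I / 2 * conj (jetY b) * G 1
          - π / 2 * conj (atomAN b) * ∫ y in (0:ℝ)..1, G y‖ ^ 2 := by
  have h := jetKappa_mul_jetForm b h01 h02 h12 hb0 hc (G 0) (G 1) (∫ y in (0:ℝ)..1, G y)
  rw [← pi_div_two_mul_dictShift_of_re_atomA0_eq_zero b hc hG] at h
  have hrow : (∑ c : Fin 3, jetMat b 0 c * jetVec (G 0) (G 1) (∫ y in (0:ℝ)..1, G y) c)
      = (π : ℂ) * ((jetKappa b : ℂ) * G 0 + I / 2 * conj (jetY b) * G 1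
          - π / 2 * conj (atomAN b) * ∫ y in (0:ℝ)..1, G y) := by
    simp only [Fin.sum_univ_three, jetMat_00, jetMat_01, jetMat_02, jetVec_0, jetVec_1, jetVec_2]
    push_cast
    ring
  rw [hrow, norm_mul, mul_pow, Complex.norm_real, Real.norm_eq_abs, abs_of_pos Real.pi_pos] at h
  have h' : π * jetKappa b * (π / 2 * DictShift b G G')
      = π ^ 2 * ‖(jetKappa b : ℂ) * G 0 + I / 2 * conj (jetY b) * G 1
          - π / 2 * conj (atomAN b) * ∫ y in (0:ℝ)..1, G y‖ ^ 2 := by exact_mod_cast h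
  have hπ : (π : ℝ) ^ 2 ≠ 0 := by positivity
  apply mul_left_cancel₀ hπ
  linear_combination 2 * h'

/-- **`π·κ_b·λ_b = ‖m₀₀‖² + ‖m₀₁‖² + ‖m₀₂‖² ≥ 0` on the locus** (the first row of a rank-one Hermitian matrix against
its trace): so `λ_b` has the sign of `κ_b` wherever `κ_b ≠ 0`. [cite: Zhang2022LandauSiegel, Prop 7.1 p.44 with (8.11)–(8.23); §18 (18.1)] -/
theorem pi_mul_jetKappa_mul_jetTrace (h01 : b 0 ≠ b 1) (h02 : b 0 ≠ b 2) (h12 : b 1 ≠ b 2) (hb0 : ∀ j, b j ≠ 0)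
    (hc : (atomA0 b).re = 0) :
    π * jetKappa b * jetTrace b = ‖jetMat b 0 0‖ ^ 2 + ‖jetMat b 0 1‖ ^ 2 + ‖jetMat b 0 2‖ ^ 2 := by
  have hm := jetMat_minors_eq_zero b h01 h02 h12 hb0 hc
  have e1 := hm 0 1 0 1
  have e2 := hm 0 2 0 2
  have h10 : jetMat b 1 0 = conj (jetMat b 0 1) := (jetMat_conj b 0 1).symm
  have h20 : jetMat b 2 0 = conj (jetMat b 0 2) := (jetMat_conj b 0 2).symm
  have h00 : conj (jetMat b 0 0) = jetMat b 0 0 := jetMat_conj b 0 0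
  rw [h10] at e1
  rw [h20] at e2
  have key : ((π * jetKappa b : ℝ) : ℂ) * ((jetTrace b : ℝ) : ℂ)
      = jetMat b 0 0 * conj (jetMat b 0 0) + jetMat b 0 1 * conj (jetMat b 0 1)
        + jetMat b 0 2 * conj (jetMat b 0 2) := by
    rw [← jetMat_trace, ← jetMat_00, h00]
    linear_combination e1 + e2
  rw [Complex.mul_conj', Complex.mul_conj', Complex.mul_conj'] at key
  exact_mod_cast key

/-- **On the sub-locus `c₀(b) = 0, κ_b = 0`:** `Y_b = 0` and `A_N(b) = 0` (the minors `|m₀₁|² = m₀₀m₁₁ = 0`,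
`|m₀₂|² = m₀₀m₂₂ = 0`). [cite: Zhang2022LandauSiegel, Prop 7.1 p.44 with (8.11)–(8.23); Lemma 15.1] -/
theorem jetY_eq_zero_of_jetKappa_eq_zero (h01 : b 0 ≠ b 1) (h02 : b 0 ≠ b 2) (h12 : b 1 ≠ b 2) (hb0 : ∀ j, b j ≠ 0)
    (hc : (atomA0 b).re = 0) (hκ : jetKappa b = 0) : jetY b = 0 ∧ atomAN b = 0 := by
  have hk := pi_mul_jetKappa_mul_jetTrace b h01 h02 h12 hb0 hc
  rw [hκ, mul_zero, zero_mul] at hk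
  have h1 : ‖jetMat b 0 1‖ ^ 2 = 0 := by nlinarith [sq_nonneg ‖jetMat b 0 0‖, sq_nonneg ‖jetMat b 0 1‖, sq_nonneg ‖jetMat b 0 2‖]
  have h2 : ‖jetMat b 0 2‖ ^ 2 = 0 := by nlinarith [sq_nonneg ‖jetMat b 0 0‖, sq_nonneg ‖jetMat b 0 1‖, sq_nonneg ‖jetMat b 0 2‖]
  rw [sq_eq_zero_iff, norm_eq_zero] at h1 h2
  rw [jetMat_01] at h1
  rw [jetMat_02] at h2
  have hπ : (π : ℂ) ≠ 0 := by exact_mod_cast Real.pi_ne_zero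
  have hI : (I : ℂ) ≠ 0 := Complex.I_ne_zero
  constructor
  · have h : conj (jetY b) = 0 := by simpa [hπ, hI] using h1
    simpa using congrArg conj h
  · have h : conj (atomAN b) = 0 := by simpa [hπ] using h2
    simpa using congrArg conj h

/-- **The form on the sub-locus `c₀(b) = 0, κ_b = 0`:** `DictShift_b(G) = −π²e₃·Im A₀(b)·‖∫₀¹G‖²` for every kinked
`G` (so PSD there iff `Im A₀ ≤ 0` iff `0 ≤ λ_b`; at `(2,4,6)` also `Im A₀ = 0`, form `≡ 0`).
[cite: Zhang2022LandauSiegel, §4 (4.1); Prop 7.1 p.44 with (8.11)–(8.23); §18 (18.1)] -/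
theorem dictShift_eq_of_jetKappa_eq_zero (h01 : b 0 ≠ b 1) (h02 : b 0 ≠ b 2) (h12 : b 1 ≠ b 2) (hb0 : ∀ j, b j ≠ 0)
    (hc : (atomA0 b).re = 0) (hκ : jetKappa b = 0) (hG : KinkedProfile G G') :
    DictShift b G G' = -(π ^ 2 * symE3 b * (atomA0 b).im) * ‖∫ y in (0:ℝ)..1, G y‖ ^ 2 := by
  obtain ⟨hY, hN⟩ := jetY_eq_zero_of_jetKappa_eq_zero b h01 h02 h12 hb0 hc hκ
  have hform := jetForm_eq_jetMat b (G 0) (G 1) (∫ y in (0:ℝ)..1, G y)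
  rw [← pi_div_two_mul_dictShift_of_re_atomA0_eq_zero b hc hG] at hform
  simp only [Fin.sum_univ_three, jetVec_0, jetVec_1, jetVec_2, jetMat_00, jetMat_01, jetMat_02, jetMat_10,
    jetMat_11, jetMat_12, jetMat_20, jetMat_21, jetMat_22, hκ, hY, hN, map_zero, mul_zero, zero_mul, neg_zero,
    zero_div, add_zero, zero_add, Complex.ofReal_zero] at hform
  have h' : ((π / 2 * DictShift b G G' : ℝ) : ℂ)
      = ((-(π ^ 3 / 2 * symE3 b * (atomA0 b).im) * ‖∫ y in (0:ℝ)..1, G y‖ ^ 2 : ℝ) : ℂ) := by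
    rw [hform]
    push_cast
    rw [← Complex.mul_conj']
    ring
  have h'' : π / 2 * DictShift b G G' = -(π ^ 3 / 2 * symE3 b * (atomA0 b).im) * ‖∫ y in (0:ℝ)..1, G y‖ ^ 2 := by
    exact_mod_cast h'
  have hπ : (π / 2 : ℝ) ≠ 0 := by positivity
  apply mul_left_cancel₀ hπ
  linear_combination h''

end Locus

/-! ### Part 5 — the complete sharpness equivalence -/

section Complete

variable (b : Fin 3 → ℝ)

/-- **PSD on the locus when `λ_b ≥ 0`:** `0 ≤ DictShift_b(G)` for every kinked `G` (if `λ_b > 0` divide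
`λ_b·(π/2)·DictShift = ‖M_bv‖² ≥ 0`; if `λ_b = 0` then `M_bv = 0`, so `J_b(v) = 0`).
[cite: Zhang2022LandauSiegel, §4 (4.1); Prop 7.1 p.44 with (8.11)–(8.23); §18 (18.1)] -/
theorem dictShift_nonneg_of_jetTrace_nonneg (h01 : b 0 ≠ b 1) (h02 : b 0 ≠ b 2) (h12 : b 1 ≠ b 2)
    (hb0 : ∀ j, b j ≠ 0) (hc : (atomA0 b).re = 0) (ht : 0 ≤ jetTrace b) (hG : KinkedProfile G G') :
    0 ≤ DictShift b G G' := by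
  have h := jetTrace_mul_dictShift b h01 h02 h12 hb0 hc hG
  have hS : 0 ≤ ∑ r : Fin 3, ‖∑ c : Fin 3, jetMat b r c * jetVec (G 0) (G 1) (∫ y in (0:ℝ)..1, G y) c‖ ^ 2 :=
    Finset.sum_nonneg fun r _ => by positivity
  rcases ht.eq_or_lt with hzero | hpos
  · rw [← hzero, zero_mul] at h
    have hz : ∀ r : Fin 3, ∑ c : Fin 3, jetMat b r c * jetVec (G 0) (G 1) (∫ y in (0:ℝ)..1, G y) c = 0 := by
      intro r
      have := (Finset.sum_eq_zero_iff_of_nonneg fun r _ => sq_nonneg _).1 h.symm r (Finset.mem_univ r)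
      exact norm_eq_zero.1 ((pow_eq_zero_iff two_ne_zero).1 this)
    have hJ := jetForm_eq_sum_mulVec b (G 0) (G 1) (∫ y in (0:ℝ)..1, G y)
    rw [← pi_div_two_mul_dictShift_of_re_atomA0_eq_zero b hc hG] at hJ
    simp only [hz, mul_zero, Finset.sum_const_zero, Complex.ofReal_eq_zero] at hJ
    have hπ : (π / 2 : ℝ) ≠ 0 := by positivity
    have : DictShift b G G' = 0 := (mul_eq_zero.1 hJ).resolve_left hπ
    rw [this]
  · have h2 : 0 ≤ π / 2 * DictShift b G G' := by
      by_contra hneg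
      push Not at hneg
      have := mul_neg_of_pos_of_neg hpos hneg
      linarith
    exact (mul_nonneg_iff_of_pos_left (by positivity : (0:ℝ) < π / 2)).1 h2

/-- **`Det.DictShiftPSD b` on the locus when `λ_b ≥ 0`** (the `H¹` lift `Det.dictShiftPSD_of_kinked`).
[cite: Zhang2022LandauSiegel, §4 (4.1); §2 (2.18)–(2.19); Prop 7.1 p.44] -/
theorem dictShiftPSD_of_jetTrace_nonneg (h01 : b 0 ≠ b 1) (h02 : b 0 ≠ b 2) (h12 : b 1 ≠ b 2)
    (hb0 : ∀ j, b j ≠ 0) (hc : (atomA0 b).re = 0) (ht : 0 ≤ jetTrace b) : DictShiftPSD b :=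
  dictShiftPSD_of_kinked fun _ _ hG => dictShift_nonneg_of_jetTrace_nonneg b h01 h02 h12 hb0 hc ht hG

/-- The profile `y ↦ y` is kinked. [folklore] -/
private theorem kinkedProfile_id' : KinkedProfile (fun y : ℝ => (y : ℂ)) (fun _ => (1 : ℂ)) where
  cont := Complex.continuous_ofReal.continuousOn
  hasDeriv := fun x _ => by
    have h := (hasDerivAt_id' x).ofReal_comp
    rw [Complex.ofReal_one] at h
    exact h.hasDerivWithinAt
  memLp := memLp_two_of_continuousOn_Icc' continuousOn_const

/-- The profile `y ↦ y²` is kinked. [folklore] -/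
private theorem kinkedProfile_sq' : KinkedProfile (fun y : ℝ => ((y ^ 2 : ℝ) : ℂ)) (fun y => ((2 * y : ℝ) : ℂ)) where
  cont := (Complex.continuous_ofReal.comp (continuous_pow 2)).continuousOn
  hasDeriv := fun x _ => by
    have h := (hasDerivAt_pow 2 x).ofReal_comp
    refine (h.congr_deriv ?_).hasDerivWithinAt
    push_cast
    ring
  memLp := memLp_two_of_continuousOn_Icc' (Complex.continuous_ofReal.comp (continuous_const.mul continuous_id)).continuousOn

/-- The constant profile `1` is kinked. [folklore] -/
private theorem kinkedProfile_one' : KinkedProfile (fun _ : ℝ => (1 : ℂ)) (fun _ => (0 : ℂ)) where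
  cont := continuousOn_const
  hasDeriv := fun x _ => hasDerivWithinAt_const x _ _
  memLp := by simp

/-- `∫₀¹ y dy = 1/2` (complex-valued). [folklore] -/
private theorem integral_id' : ∫ y in (0:ℝ)..1, ((y : ℝ) : ℂ) = 1 / 2 := by
  rw [intervalIntegral.integral_ofReal, integral_id]
  push_cast
  norm_num

/-- `∫₀¹ y² dy = 1/3` (complex-valued). [folklore] -/
private theorem integral_sq' : ∫ y in (0:ℝ)..1, ((y ^ 2 : ℝ) : ℂ) = 1 / 3 := by
  rw [intervalIntegral.integral_ofReal, integral_pow]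
  push_cast
  norm_num

/-- **NOT PSD on the locus when `λ_b < 0`:** if `DictShift_b ≥ 0` on all `H¹` profiles then `M_b v = 0` for the jet
vectors of every kinked profile; the jets of `1`, `y`, `y²` span `ℂ³`, so `M_b = 0` and `λ_b = tr M_b = 0` —
contradiction. [cite: Zhang2022LandauSiegel, §4 (4.1); Prop 7.1 p.44 with (8.11)–(8.23); §18 (18.1)] -/
theorem not_dictShiftPSD_of_jetTrace_neg (h01 : b 0 ≠ b 1) (h02 : b 0 ≠ b 2) (h12 : b 1 ≠ b 2)
    (hb0 : ∀ j, b j ≠ 0) (hc : (atomA0 b).re = 0) (ht : jetTrace b < 0) : ¬ DictShiftPSD b := by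
  intro hP
  have hz : ∀ F F' : ℝ → ℂ, KinkedProfile F F' →
      ∀ r : Fin 3, ∑ c : Fin 3, jetMat b r c * jetVec (F 0) (F 1) (∫ y in (0:ℝ)..1, F y) c = 0 := by
    intro F F' hF r
    have h := jetTrace_mul_dictShift b h01 h02 h12 hb0 hc hF
    have hD : 0 ≤ DictShift b F F' := hP F F' hF.isH1
    have hS : 0 ≤ ∑ r : Fin 3, ‖∑ c : Fin 3, jetMat b r c * jetVec (F 0) (F 1) (∫ y in (0:ℝ)..1, F y) c‖ ^ 2 :=
      Finset.sum_nonneg fun r _ => by positivity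
    have hS0 : ∑ r : Fin 3, ‖∑ c : Fin 3, jetMat b r c * jetVec (F 0) (F 1) (∫ y in (0:ℝ)..1, F y) c‖ ^ 2 = 0 := by
      have : jetTrace b * (π / 2 * DictShift b F F') ≤ 0 :=
        mul_nonpos_of_nonpos_of_nonneg ht.le (by positivity)
      linarith
    have := (Finset.sum_eq_zero_iff_of_nonneg fun r _ => sq_nonneg _).1 hS0 r (Finset.mem_univ r)
    exact norm_eq_zero.1 ((pow_eq_zero_iff two_ne_zero).1 this)
  have w1 := hz _ _ kinkedProfile_one'
  have w2 := hz _ _ kinkedProfile_id'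
  have w3 := hz _ _ kinkedProfile_sq'
  simp only [Fin.sum_univ_three, jetVec_0, jetVec_1, jetVec_2, integral_id', integral_sq', Complex.ofReal_zero,
    Complex.ofReal_one, ne_eq, OfNat.ofNat_ne_zero, not_false_eq_true, zero_pow, one_pow,
    intervalIntegral.integral_const, sub_zero, one_smul, mul_one, mul_zero, zero_add] at w1 w2 w3
  have d0 : jetMat b 0 0 = 0 := by linear_combination w1 0 - 4 * w2 0 + 3 * w3 0
  have d1 : jetMat b 1 1 = 0 := by linear_combination 3 * w3 1 - 2 * w2 1
  have d2 : jetMat b 2 2 = 0 := by linear_combination 6 * (w2 2 - w3 2)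
  have htr : ((jetTrace b : ℝ) : ℂ) = 0 := by rw [← jetMat_trace, d0, d1, d2]; ring
  have : jetTrace b = 0 := by exact_mod_cast htr
  linarith

/-- **ON THE LOCUS `c₀(b) = 0` (pairwise distinct `b`, `b_j ≠ 0`): `Det.DictShiftPSD b ↔ 0 ≤ λ_b`.**
[cite: Zhang2022LandauSiegel, §2 Lemma 2.3; §4 (4.1); Prop 7.1 p.44 with (8.11)–(8.23); §18 (18.1)] -/
theorem dictShiftPSD_iff_jetTrace_nonneg (h01 : b 0 ≠ b 1) (h02 : b 0 ≠ b 2) (h12 : b 1 ≠ b 2)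
    (hb0 : ∀ j, b j ≠ 0) (hc : (atomA0 b).re = 0) : DictShiftPSD b ↔ 0 ≤ jetTrace b :=
  ⟨fun h => by
    by_contra hlt
    push Not at hlt
    exact not_dictShiftPSD_of_jetTrace_neg b h01 h02 h12 hb0 hc hlt h,
   fun ht => dictShiftPSD_of_jetTrace_nonneg b h01 h02 h12 hb0 hc ht⟩

/-- **On the locus with `κ_b ≠ 0`: `Det.DictShiftPSD b ↔ 0 < κ_b`** (`π·κ_b·λ_b = Σ_c ‖m₀c‖² > 0` there).
[cite: Zhang2022LandauSiegel, §2 Lemma 2.3; §4 (4.1); Prop 7.1 p.44 with (8.11)–(8.23); §18 (18.1)] -/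
theorem dictShiftPSD_iff_jetKappa_pos (h01 : b 0 ≠ b 1) (h02 : b 0 ≠ b 2) (h12 : b 1 ≠ b 2)
    (hb0 : ∀ j, b j ≠ 0) (hc : (atomA0 b).re = 0) (hκ : jetKappa b ≠ 0) : DictShiftPSD b ↔ 0 < jetKappa b := by
  rw [dictShiftPSD_iff_jetTrace_nonneg b h01 h02 h12 hb0 hc]
  have hk := pi_mul_jetKappa_mul_jetTrace b h01 h02 h12 hb0 hc
  have h00 : 0 < ‖jetMat b 0 0‖ ^ 2 := by
    rw [jetMat_00, Complex.norm_real, Real.norm_eq_abs]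
    exact pow_pos (abs_pos.2 (mul_ne_zero Real.pi_ne_zero hκ)) 2
  have hpos : 0 < π * jetKappa b * jetTrace b := by
    rw [hk]; nlinarith [sq_nonneg ‖jetMat b 0 1‖, sq_nonneg ‖jetMat b 0 2‖]
  constructor
  · intro ht
    by_contra hle
    push Not at hle
    have hκneg : jetKappa b < 0 := lt_of_le_of_ne hle hκ
    nlinarith [mul_pos Real.pi_pos (neg_pos.2 hκneg)]
  · intro hκpos
    by_contra hneg
    push Not at hneg
    nlinarith [mul_pos Real.pi_pos hκpos]

/-- **THE COMPLETE SHARPNESS EQUIVALENCE** for every sorted positive shift triple (the hypotheses of the tree's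
`Det.dictShiftPSD_iff_signAdmissible_of_ne`, without the proviso `c₀(b) ≠ 0`):
`Det.DictShiftPSD b ↔ Det.SignAdmissible b ∨ (Re A₀(b) = 0 ∧ 0 ≤ λ_b)` — the two-sided windowed main-term form is PSD
on `H¹` exactly on Lemma 2.3's sign-admissible box (where `c₀ > 0`) TOGETHER WITH the part `λ_b ≥ 0` of the
degenerate hypersurface `c₀(b) = 0`, on which it is the rank-one jet square `(2/λ_b)‖M_b v‖²/π` (no bulk term).
[cite: Zhang2022LandauSiegel, §2 Lemma 2.3, (2.13); §4 (4.1); Prop 7.1 p.44 with (7.2), (8.11)–(8.23); §18 (18.1)] -/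
theorem dictShiftPSD_iff_complete (h0 : 0 < b 0) (h01 : b 0 < b 1) (h12 : b 1 < b 2) :
    DictShiftPSD b ↔ SignAdmissible b ∨ ((atomA0 b).re = 0 ∧ 0 ≤ jetTrace b) := by
  have h02 : b 0 < b 2 := h01.trans h12
  have hb0 : ∀ j, b j ≠ 0 := by
    intro j; fin_cases j
    · exact h0.ne'
    · exact (h0.trans h01).ne'
    · exact (h0.trans h02).ne'
  by_cases hc : (atomA0 b).re = 0
  · rw [dictShiftPSD_iff_jetTrace_nonneg b h01.ne h02.ne h12.ne hb0 hc]
    constructor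
    · exact fun ht => Or.inr ⟨hc, ht⟩
    · rintro (hsa | ⟨-, ht⟩)
      · have hpos := re_sum_shiftW_pos hsa
        exact absurd hc (by unfold atomA0; exact hpos.ne')
      · exact ht
  · rw [dictShiftPSD_iff_signAdmissible_of_ne h0 h01 h12 hc]
    simp [hc]

end Complete

/-! ### Unit tests — the five kernel instances of `DetectorDictShiftC0Zero` recovered from the general theorem -/

section Instances

/-- `λ_(2,3,4) = −16π − 72π³`. [cite: Zhang2022LandauSiegel, Prop 7.1 p.44; §18 (18.1)] -/
theorem jetTrace_234 : jetTrace ![2, 3, 4] = -16 * π - 72 * π ^ 3 := by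
  simp only [jetTrace, jetKappa, atomAb_234, atomA0_234, symE1, symE3, Complex.mul_im, Complex.I_re, Complex.I_im,
    Complex.re_ofNat, Complex.im_ofNat, Matrix.cons_val_zero, Matrix.cons_val_one, Matrix.cons_val_two,
    Matrix.head_cons, Matrix.tail_cons]
  ring

/-- `λ_(1,3,7) = 2π`. [cite: Zhang2022LandauSiegel, Prop 7.1 p.44; §18 (18.1)] -/
theorem jetTrace_137 : jetTrace ![1, 3, 7] = 2 * π := by
  simp only [jetTrace, jetKappa, atomAb_137, atomA0_137, Complex.I_im, Complex.zero_im]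
  ring

/-- `λ_(2,4,6) = 0`. [cite: Zhang2022LandauSiegel, Prop 7.1 p.44; §18 (18.1)] -/
theorem jetTrace_246 : jetTrace ![2, 4, 6] = 0 := by
  simp only [jetTrace, jetKappa, atomAb_246, atomA0_246, Complex.one_im, Complex.zero_im]
  ring

/-- `λ_(1,2,4) = −16π/3 − 8π³/3`. [cite: Zhang2022LandauSiegel, Prop 7.1 p.44; §18 (18.1)] -/
theorem jetTrace_124 : jetTrace ![1, 2, 4] = -(16 * π / 3) - 8 * π ^ 3 / 3 := by
  simp only [jetTrace, jetKappa, atomAb_124, atomA0_124, symE1, symE3, Complex.mul_im, Complex.I_re, Complex.I_im,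
    Complex.re_ofNat, Complex.im_ofNat, Complex.div_ofNat_im, Complex.neg_im,
    Matrix.cons_val_zero, Matrix.cons_val_one, Matrix.cons_val_two, Matrix.head_cons, Matrix.tail_cons]
  ring

/-- `λ_(1,3,5) = −2π`. [cite: Zhang2022LandauSiegel, Prop 7.1 p.44; §18 (18.1)] -/
theorem jetTrace_135 : jetTrace ![1, 3, 5] = -(2 * π) := by
  simp only [jetTrace, jetKappa, atomAb_135, atomA0_135, Complex.neg_im, Complex.I_im, Complex.zero_im]
  ring

example : ¬ DictShiftPSD ![2, 3, 4] :=
  not_dictShiftPSD_of_jetTrace_neg _ (by norm_num) (by norm_num [Matrix.cons_val_two, Matrix.tail_cons, Matrix.head_cons])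
    (by norm_num [Matrix.cons_val_two, Matrix.tail_cons, Matrix.head_cons])
    (by intro j; fin_cases j <;> norm_num [Matrix.cons_val_two, Matrix.tail_cons, Matrix.head_cons]) re_atomA0_234 (by rw [jetTrace_234]; nlinarith [Real.pi_pos, pow_pos Real.pi_pos 3])

example : DictShiftPSD ![1, 3, 7] :=
  dictShiftPSD_of_jetTrace_nonneg _ (by norm_num) (by norm_num [Matrix.cons_val_two, Matrix.tail_cons, Matrix.head_cons])
    (by norm_num [Matrix.cons_val_two, Matrix.tail_cons, Matrix.head_cons])
    (by intro j; fin_cases j <;> norm_num [Matrix.cons_val_two, Matrix.tail_cons, Matrix.head_cons]) (by rw [atomA0_137]; rfl) (by rw [jetTrace_137]; positivity)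

example : DictShiftPSD ![2, 4, 6] :=
  dictShiftPSD_of_jetTrace_nonneg _ (by norm_num) (by norm_num [Matrix.cons_val_two, Matrix.tail_cons, Matrix.head_cons])
    (by norm_num [Matrix.cons_val_two, Matrix.tail_cons, Matrix.head_cons])
    (by intro j; fin_cases j <;> norm_num [Matrix.cons_val_two, Matrix.tail_cons, Matrix.head_cons]) (by rw [atomA0_246]; rfl) (by rw [jetTrace_246])

example : ¬ DictShiftPSD ![1, 2, 4] :=
  not_dictShiftPSD_of_jetTrace_neg _ (by norm_num) (by norm_num [Matrix.cons_val_two, Matrix.tail_cons, Matrix.head_cons])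
    (by norm_num [Matrix.cons_val_two, Matrix.tail_cons, Matrix.head_cons])
    (by intro j; fin_cases j <;> norm_num [Matrix.cons_val_two, Matrix.tail_cons, Matrix.head_cons]) (by rw [atomA0_124]; simp)
    (by rw [jetTrace_124]; nlinarith [Real.pi_pos, pow_pos Real.pi_pos 3])

example : ¬ DictShiftPSD ![1, 3, 5] :=
  not_dictShiftPSD_of_jetTrace_neg _ (by norm_num) (by norm_num [Matrix.cons_val_two, Matrix.tail_cons, Matrix.head_cons])
    (by norm_num [Matrix.cons_val_two, Matrix.tail_cons, Matrix.head_cons])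
    (by intro j; fin_cases j <;> norm_num [Matrix.cons_val_two, Matrix.tail_cons, Matrix.head_cons]) (by rw [atomA0_135]; rfl) (by rw [jetTrace_135]; linarith [Real.pi_pos])

end Instances

end Det

end Literature.NumberTheory.LFunctions.Zhang2022
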